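import Literature.Probability.RandomPlanarGeometry.SAWFiniteMemory
import HarnessLib

/-!
# A KERNEL-checkable certificate format for the Pönitz–Tittmann finite-memory bound on `μ(ℤ²)`

Topic `Literature/Probability/RandomPlanarGeometry`. `SAWFiniteMemory.lean` bounds the connective
constant `μ(ℤ²)` by the Perron root of the memory-`K` automaton `ptStep K` (Pönitz–Tittmann 2000,
§2–3): a Collatz–Wielandt CERTIFICATE (a positive integer weight on every reachable state with
`D · Σ_d v(δ(a,d)) ≤ N · v(a)`) proves `cₙ Dⁿ ≤ Nⁿ v([])` and hence `μ ≤ N/D`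
(`WordAutomaton.count_mul_pow_le`). There the certificate is SEARCHED and checked inside one
`native_decide` (hash maps, arrays; `check K N D iters`), so every consumer inherits the compiler axiom
(tier CHECKED-native: `μ ≤ 2.695`, `k = 16`; `μ ≤ 2.688`, `k = 18`).

This file gives the same certificate in a form the KERNEL evaluates (`decide +kernel`, axioms
`propext`/`Classical.choice`/`Quot.sound` only): the table is an explicit association LIST
`tab : List (List Step × ℕ)` (state ↦ weight, produced offline and pasted as a literal in the data
files `SAWFiniteMemoryKernelK….lean`), and the verifier `verifyL K N D tab` is structural list
recursion only.

* `wtL tab a` — the weight of the state `a` (`0` if absent);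
* `verifyL K N D tab` — the Boolean check: `1 ≤ v([]) ≤ 2⁴¹`, and for every tabulated state `a`:
  `1 ≤ v(a)`, every successor `ptStep K a d = some b` has `1 ≤ v(b)`, and
  `D · Σ_d v(succ) ≤ N · v(a)`;
* `certificate_of_verifyL` — soundness: a `WordAutomaton.Certificate (ptStep K)` on
  `{a | 1 ≤ v(a)}`; `count_mul_pow_le_of_verifyL` — `cₙ Dⁿ ≤ Nⁿ 2⁴¹`;
* `connectiveConstant_le_of_count_bound` / **`connectiveConstant_le_of_verifyL`** — `μ(ℤ²) ≤ N/D`.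

Instances (kernel tier): `K = 8`, `569` states, `μ ≤ 2.7445` (`SAWFiniteMemoryKernelK8.lean`).

## References

* [PonitzTittmann2000] A. Pönitz, P. Tittmann, *Improved upper bounds for self-avoiding walks in ℤᵈ*,
  Electron. J. Combin. 7 (2000) R21, §2 (the automaton), §3 (eigenvalue bound), Table 2.
* [MadrasSlade1993] N. Madras, G. Slade, *The Self-Avoiding Walk* (1993), §1.2 (`μ ≤ μ_τ`).
-/

open Finset Filter Topology Literature.Probability.LatticeModels
open scoped BigOperators

namespace Literature.Probability.RandomPlanarGeometry.SAW

namespace FiniteMemory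

/-! ### The list certificate and its verifier (structural recursion only) -/

/-- The weight of a state in the association list (`0` if the state is absent; first match).
[cite: PonitzTittmann2000, §3 (the positive eigenvector)] -/
def wtL : List (List Step × ℕ) → List Step → ℕ
  | [], _ => 0
  | (b, v) :: t, a => if a = b then v else wtL t a

/-- Check of one tabulated state `a`: positive weight, every successor has positive weight (hence
is tabulated), and the Collatz–Wielandt inequality `D · Σ_d v(δ(a,d)) ≤ N · v(a)`.
[cite: PonitzTittmann2000, §3] -/
def verifyStateL (K N D : ℕ) (tab : List (List Step × ℕ)) (a : List Step) : Bool :=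
  decide (1 ≤ wtL tab a) &&
    (List.finRange 4).all (fun d =>
      match ptStep K a d with
      | none => true
      | some b => decide (1 ≤ wtL tab b)) &&
    decide (D * ((List.finRange 4).map fun d => ((ptStep K a d).map (wtL tab)).getD 0).sum ≤
      N * wtL tab a)

/-- **The kernel certificate check**: the root has weight in `[1, 2⁴¹]` and every tabulated state
passes `verifyStateL`. Evaluated by `decide +kernel` in the data files.
[cite: PonitzTittmann2000, §3] -/
def verifyL (K N D : ℕ) (tab : List (List Step × ℕ)) : Bool :=
  decide (1 ≤ wtL tab []) && decide (wtL tab [] ≤ 2 ^ 41) &&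
    tab.all (fun av => verifyStateL K N D tab av.1)

/-- A state of positive weight occurs as a key of the table. [folklore] -/
private theorem exists_mem_of_wtL_pos {tab : List (List Step × ℕ)} {a : List Step}
    (h : 1 ≤ wtL tab a) : ∃ v, (a, v) ∈ tab := by
  induction tab with
  | nil => simp [wtL] at h
  | cons bv t ih =>
    obtain ⟨b, v⟩ := bv
    by_cases hab : a = b
    · subst hab
      exact ⟨v, List.mem_cons_self⟩
    · simp only [wtL, if_neg hab] at h
      obtain ⟨v', hv'⟩ := ih h
      exact ⟨v', List.mem_cons_of_mem _ hv'⟩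

/-- **Soundness of `verifyL`**: a successful check is a Collatz–Wielandt certificate for `ptStep K`
on the states of positive weight, with root weight `≤ 2⁴¹`. [cite: PonitzTittmann2000, §3] -/
theorem certificate_of_verifyL {K N D : ℕ} {tab : List (List Step × ℕ)}
    (h : verifyL K N D tab = true) :
    WordAutomaton.Certificate (ptStep K) {a | 1 ≤ wtL tab a} (wtL tab) N D ∧ wtL tab [] ≤ 2 ^ 41 := by
  simp only [verifyL, Bool.and_eq_true, decide_eq_true_eq, List.all_eq_true] at h
  obtain ⟨⟨h0, hroot⟩, hall⟩ := h
  have key : ∀ a : List Step, 1 ≤ wtL tab a →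
      (∀ d b, ptStep K a d = some b → 1 ≤ wtL tab b) ∧
      D * ∑ d : Step, ((ptStep K a d).map (wtL tab)).getD 0 ≤ N * wtL tab a := by
    intro a ha
    obtain ⟨v, hv⟩ := exists_mem_of_wtL_pos ha
    have hs := hall (a, v) hv
    simp only [verifyStateL, Bool.and_eq_true, decide_eq_true_eq, List.all_eq_true] at hs
    obtain ⟨⟨-, hsucc⟩, hcw⟩ := hs
    refine ⟨fun d b hb => ?_, ?_⟩
    · have := hsucc d (List.mem_finRange d)
      rw [hb] at this
      simpa using this
    · have e : ((List.finRange 4).map fun d => ((ptStep K a d).map (wtL tab)).getD 0).sum =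
          ∑ d : Step, ((ptStep K a d).map (wtL tab)).getD 0 := by
        rw [← List.sum_ofFn, List.ofFn_eq_map]
      rw [← e]
      exact hcw
  refine ⟨⟨h0, ?_, ?_, ?_⟩, hroot⟩
  · intro a ha d b hb
    exact (key a ha).1 d b hb
  · intro a ha
    exact ha
  · intro a ha
    exact (key a ha).2

/-- **`cₙ · Dⁿ ≤ Nⁿ · 2⁴¹`** from a successful kernel certificate check. [cite: PonitzTittmann2000, §3] -/
theorem count_mul_pow_le_of_verifyL {K N D : ℕ} {tab : List (List Step × ℕ)}
    (h : verifyL K N D tab = true) (n : ℕ) : count n * D ^ n ≤ N ^ n * 2 ^ 41 := by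
  obtain ⟨hc, hroot⟩ := certificate_of_verifyL h
  exact le_trans (WordAutomaton.count_mul_pow_le hc (run_ne_none_of_isSAW K) n)
    (Nat.mul_le_mul_left _ hroot)

/-- **`μ(ℤ²) ≤ N/D` from the counting bound `cₙ Dⁿ ≤ Nⁿ 2⁴¹`** (`μ ≤ cₙ^{1/n} ≤ (N/D)·2^{41/n} → N/D`);
the argument of `connectiveConstant_le_of_check`, with the count bound as hypothesis.
[cite: PonitzTittmann2000, §3] -/
theorem connectiveConstant_le_of_count_bound {N D : ℕ} (h : ∀ n, count n * D ^ n ≤ N ^ n * 2 ^ 41)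
    (hD : 0 < D) : connectiveConstant ≤ (N : ℝ) / D := by
  have hND : (0 : ℝ) ≤ (N : ℝ) / D := by positivity
  set C : ℝ := (2 : ℝ) ^ 41 with hC_def
  have hC : 0 < C := by positivity
  have hle : ∀ n : ℕ, connectiveConstant ≤ (N : ℝ) / D * C ^ ((n : ℝ) + 1)⁻¹ := by
    intro n
    have hn : (n + 1 : ℕ) ≠ 0 := Nat.succ_ne_zero n
    have h1 : connectiveConstant ≤ (count (n + 1) : ℝ) ^ (1 / ((n : ℝ) + 1)) := by
      have := Zd.connectiveConstant_le_rpow (d := 2) hn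
      rw [Zd.connectiveConstant_two, Zd.count_two] at this
      simpa [Nat.cast_succ] using this
    have h2 : (count (n + 1) : ℝ) ≤ ((N : ℝ) / D) ^ (n + 1) * C := by
      have h3 := h (n + 1)
      have h4 : (count (n + 1) : ℝ) * (D : ℝ) ^ (n + 1) ≤ (N : ℝ) ^ (n + 1) * C := by
        rw [hC_def]; exact_mod_cast h3
      have hDpos : (0 : ℝ) < (D : ℝ) ^ (n + 1) := by positivity
      rw [div_pow, div_mul_eq_mul_div, le_div_iff₀ hDpos]
      exact h4
    have hexp : (0 : ℝ) ≤ 1 / ((n : ℝ) + 1) := by positivity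
    calc connectiveConstant ≤ (count (n + 1) : ℝ) ^ (1 / ((n : ℝ) + 1)) := h1
      _ ≤ (((N : ℝ) / D) ^ (n + 1) * C) ^ (1 / ((n : ℝ) + 1)) :=
          Real.rpow_le_rpow (Nat.cast_nonneg _) h2 hexp
      _ = (N : ℝ) / D * C ^ ((n : ℝ) + 1)⁻¹ := by
          rw [Real.mul_rpow (pow_nonneg hND _) hC.le, one_div]
          congr 1
          have : ((n : ℝ) + 1) = ((n + 1 : ℕ) : ℝ) := by push_cast; ring
          rw [this, Real.pow_rpow_inv_natCast hND hn]
  have hlim : Tendsto (fun n : ℕ => (N : ℝ) / D * C ^ ((n : ℝ) + 1)⁻¹) atTop (𝓝 ((N : ℝ) / D)) := by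
    have := (tendsto_const_rpow_inv hC).const_mul ((N : ℝ) / D)
    rwa [mul_one] at this
  exact ge_of_tendsto' hlim hle

/-- **`μ(ℤ²) ≤ N/D` from a successful KERNEL certificate check.** [cite: PonitzTittmann2000, §3 and Table 2] -/
theorem connectiveConstant_le_of_verifyL {K N D : ℕ} {tab : List (List Step × ℕ)}
    (h : verifyL K N D tab = true) (hD : 0 < D) : connectiveConstant ≤ (N : ℝ) / D :=
  connectiveConstant_le_of_count_bound (count_mul_pow_le_of_verifyL h) hD

end FiniteMemory

end Literature.Probability.RandomPlanarGeometry.SAW
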